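import Literature.AlgebraicGeometry.ShimuraVarieties.UnitaryBallFubiniStudyWeightLaw
import HarnessLib

/-!
# The weight law of Fubini–Study classes on a ball quotient, PROVED (weighted potential descent)

Layer `Literature/AlgebraicGeometry/ShimuraVarieties`, grouping namespace `BallFS`; sequel of
`UnitaryBallFubiniStudyWeightLaw` (the named fact `BallFS.fsFormClass_weight_comm`, row B3-25′ / `L_FS` of the
cell `hodgecm-mathlib`) and of `UnitaryBallAutomorphicFubiniStudyExact` (the same-weight case).  Everything here is
PROVED; the file discharges the named fact: **`BallFS.fsFormClass_weight_comm_holds : fsFormClass_weight_comm`**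
(net Literature debt −1).

ROAD («weighted potential descent», no Segre product).  For two projective systems `G : 𝔹² → ℂᴺ⁺¹`,
`G' : 𝔹² → ℂᴺ'⁺¹` of automorphic forms of weights `k`, `k'` for `Δ`, and a local section `s_p` of `𝔹² → Δ\𝔹²`,
changing the section `s_p ↦ δ s_p` (`δ ∈ Δ`, locally constant) rescales BOTH lifted systems by powers of ONE
function `u = j(δ, s_p ·)⁻¹`: `G ∘ (δ s_p) = uᵏ · (G ∘ s_p)` and `G' ∘ (δ s_p) = u^{k'} · (G' ∘ s_p)` (automorphy).
The Fubini–Study potential `α₀(Z) = Im ⟪Z, ·⟫/‖Z‖²` satisfies `(uⁿ H)^*α₀ = H^*α₀ + n · Im(du/u)`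
(`fsPotentialMForm_pullback_pow_smul_apply`, induction on `n` from the tree's projective variance of `α₀`), so the
WEIGHTED difference `k' · (G ∘ s_p)^*α₀ − k · (G' ∘ s_p)^*α₀` does not depend on the section (the corrections
`k'k · Im(du/u)` and `kk' · Im(du/u)` cancel): it is a smooth global real `1`-form `fsPotDiffW` on `Δ\𝔹²`
(`fsPotDiffW_eq_of_mem_source`, `isSmoothForm_fsPotDiffW`) with
`d(fsPotDiffW) = k' · [G]^*ω_FS − k · [G']^*ω_FS` (`weight_smul_fsForm_sub_eq_mextDeriv`), whence
`k' · [[G]^*ω_FS] = k · [[G']^*ω_FS]` in `H²_dR(Δ\𝔹²; ℝ)` (Griffiths–Harris Ch. 1 §2: `[[G]^*ω_FS] = c₁([G]^*𝒪(1))`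
and `[G]^*𝒪(1) = K^{⊗k}`, so `[[G]^*ω_FS] = k · c₁(K)`).

## References

* P. Griffiths, J. Harris, *Principles of Algebraic Geometry* (1978), Ch. 0 §2 (Fubini–Study form and its
  potential), Ch. 1 §2 (the pull-back of the hyperplane bundle under the map of a linear system).
  [GriffithsHarrisPrinciples1978]
* I. R. Shafarevich, *Basic Algebraic Geometry 2* (Springer 1994), Ch. IX §3.1–3.2 (automorphic forms of weight `k`
  as sections of `K^{⊗k}`; (9.19) `F(γ z) = j(γ,z)⁻ᵏ F(z)`). [Shafarevich1994]
* C. Voisin, *Hodge Theory and Complex Algebraic Geometry I* (2002), §3.3.2 Lemma 3.16. [VoisinHodgeI2002]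

## Provenance

hodgecm-mathlib cell, seat B-p11 (g3), row B3-25′ (`L_FS`), second road to the typer's Segre-product road
(B-typ03); kernel-checked, no named facts, no instance, no notation.
-/

set_option autoImplicit false

noncomputable section

open scoped Manifold ContDiff Topology InnerProductSpace ComplexConjugate
open Set Function MulAction Filter Complex
open Literature.Geometry.ComplexHyperbolic
open Literature.Geometry.ComplexHyperbolic.BallModel (U21 Ball)
open Literature.Geometry.Manifold
open Literature.Geometry.Kaehler
open Literature.Topology.FourManifolds
open Literature.NumberTheory.Automorphic.AutomorphyFactor

namespace Literature.AlgebraicGeometry.ShimuraVarieties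

namespace BallFS

open BallForms (canonicalFactor canonicalCocycle canonicalFactor_ne_zero)
open BallDescent (chart mk_mem_chart_source chart_mk_self mk_chart contMDiffAt_chart
  mdifferentiableAt_chart transAt transAt_smul eventually_transAt_eq isHolCocycle_canonicalFactor_pow
  isHolCocycle_canonicalFactor)

/-! ### The potential of a rescaled system: `(fG)^*α₀ = G^*α₀ + Im(df/f)`, `(uⁿ G)^*α₀ = G^*α₀ + n Im(du/u)` -/

section Potential

variable {W : Type*} [NormedAddCommGroup W] [InnerProductSpace ℂ W]
  {EN : Type*} [NormedAddCommGroup EN] [NormedSpace ℝ EN]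
  {HN : Type*} [TopologicalSpace HN] {IN : ModelWithCorners ℝ EN HN}
  {M : Type*} [TopologicalSpace M] [ChartedSpace HN M]

/-- **Projective variance of the pulled-back potential, explicit form**: for `f : M → ℂ` and `G : M → W`
differentiable and non-zero at `x`, `((fG)^*α₀)_x(v) = (G^*α₀)_x(v) + Im(f̄ · df_x(v)) / |f|²`, i.e. the correction
term is `Im(df/f)`. [cite: GriffithsHarrisPrinciples1978, Ch. 0 §2] -/
theorem fsPotentialMForm_pullback_smul_apply {f : M → ℂ} {G : M → W} {x : M}
    (hf : MDifferentiableAt IN 𝓘(ℝ, ℂ) f x) (hG : MDifferentiableAt IN 𝓘(ℝ, W) G x)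
    (hf0 : f x ≠ 0) (hG0 : G x ≠ 0) (v : Fin 1 → TangentSpace IN x) :
    (fsPotentialMForm (W := W)).pullback IN (fun y ↦ f y • G y) x v =
      (fsPotentialMForm (W := W)).pullback IN G x v +
        (‖f x‖ ^ 2)⁻¹ * (conj (f x) * mvfderiv IN f x (v 0)).im := by
  simp only [fsPotentialMForm_pullback_apply, mvfderiv_smul_complex_apply hf hG]
  exact fubiniStudyPotential_smul_add_smul hG0 hf0 _ _

/-- **The potential of a system rescaled by a power**: `((uⁿ G)^*α₀)_x(v) = (G^*α₀)_x(v) + n · Im(ū · du_x(v)) / |u|²`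
— the correction term of `α₀` is additive under products of scalar functions, so a power `uⁿ` contributes
`n · Im(du/u)` (induction on `n`). [cite: GriffithsHarrisPrinciples1978, Ch. 0 §2] -/
theorem fsPotentialMForm_pullback_pow_smul_apply {u : M → ℂ} {G : M → W} {x : M}
    (hu : MDifferentiableAt IN 𝓘(ℝ, ℂ) u x) (hG : MDifferentiableAt IN 𝓘(ℝ, W) G x)
    (hu0 : u x ≠ 0) (hG0 : G x ≠ 0) (n : ℕ) (v : Fin 1 → TangentSpace IN x) :
    (fsPotentialMForm (W := W)).pullback IN (fun y ↦ u y ^ n • G y) x v =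
      (fsPotentialMForm (W := W)).pullback IN G x v +
        n * ((‖u x‖ ^ 2)⁻¹ * (conj (u x) * mvfderiv IN u x (v 0)).im) := by
  induction n with
  | zero =>
    have h : (fun y ↦ u y ^ 0 • G y) = G := funext fun y ↦ by rw [pow_zero, one_smul]
    rw [h, Nat.cast_zero, zero_mul, add_zero]
  | succ n ih =>
    have hpow : MDifferentiableAt IN 𝓘(ℝ, ℂ) (fun y ↦ u y ^ n) x := hu.pow n
    have hGn : MDifferentiableAt IN 𝓘(ℝ, W) (fun y ↦ u y ^ n • G y) x :=
      (hasMFDerivAt_smul_complex hpow.hasMFDerivAt hG.hasMFDerivAt).mdifferentiableAt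
    have hGn0 : u x ^ n • G x ≠ 0 := smul_ne_zero (pow_ne_zero _ hu0) hG0
    have h : (fun y ↦ u y ^ (n + 1) • G y) = fun y ↦ u y • (u y ^ n • G y) :=
      funext fun y ↦ by rw [pow_succ', mul_smul]
    rw [h, fsPotentialMForm_pullback_smul_apply hu hGn hu0 hGn0, ih, Nat.cast_succ]
    ring

end Potential

/-! ### Two systems of weights `k`, `k'`: `k' · [G]^*ω_FS − k · [G']^*ω_FS` is exact -/

section TwoWeights

variable {Δ : Subgroup U21} [ProperlyDiscontinuousSMul Δ Ball] [IsCancelSMul Δ Ball] {N N' k k' : ℕ}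
  {G : Ball → EuclideanSpace ℂ (Fin (N + 1))} {G' : Ball → EuclideanSpace ℂ (Fin (N' + 1))}
  (hGh : MDifferentiable 𝓘(ℂ, Fin 2 → ℂ) 𝓘(ℂ, EuclideanSpace ℂ (Fin (N + 1))) G)
  (hG : G ∈ factorForms Δ (canonicalCocycle (EuclideanSpace ℂ (Fin (N + 1))) k)) (h0 : ∀ z, G z ≠ 0)
  (hGh' : MDifferentiable 𝓘(ℂ, Fin 2 → ℂ) 𝓘(ℂ, EuclideanSpace ℂ (Fin (N' + 1))) G')
  (hG' : G' ∈ factorForms Δ (canonicalCocycle (EuclideanSpace ℂ (Fin (N' + 1))) k')) (h0' : ∀ z, G' z ≠ 0)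

variable (Δ k k' G G') in
/-- **The primitive of `k' · [G]^*ω_FS − k · [G']^*ω_FS`**: at `y`, the weighted difference
`k' · (G ∘ s)^*α₀ − k · (G' ∘ s)^*α₀` of the pulled-back Fubini–Study potentials through the local section
`s = s_{out y}` (independent of the section, `fsPotDiffW_eq_of_mem_source`). [cite: GriffithsHarrisPrinciples1978, Ch. 0 §2] -/
def fsPotDiffW : MForm 𝓘(ℝ, Fin 2 → ℂ) (orbitRel.Quotient Δ Ball) ℝ 1 := fun y ↦
  (k' : ℝ) • (fsPotentialMForm (W := EuclideanSpace ℂ (Fin (N + 1)))).pullback 𝓘(ℝ, Fin 2 → ℂ)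
      (G ∘ chart Δ (Quotient.out y)) y -
    (k : ℝ) • (fsPotentialMForm (W := EuclideanSpace ℂ (Fin (N' + 1)))).pullback 𝓘(ℝ, Fin 2 → ℂ)
      (G' ∘ chart Δ (Quotient.out y)) y

include hGh hG h0 hGh' hG' h0' in
/-- **Independence of the section** (the heart of the weight law): for EVERY `p` with `y` in the source of `s_p`,
`fsPotDiffW y = k' · (G ∘ s_p)^*α₀ − k · (G' ∘ s_p)^*α₀` at `y`.  Two sections differ by a locally constant `δ ∈ Δ`;
by automorphy `G ∘ (δ s_p) = uᵏ (G ∘ s_p)`, `G' ∘ (δ s_p) = u^{k'} (G' ∘ s_p)` with the SAME `u = j(δ, s_p ·)⁻¹`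
([Shafarevich1994] (9.19)), and the corrections `k' · k Im(du/u)`, `k · k' Im(du/u)` of the two weighted potentials
cancel. [cite: Shafarevich1994, Ch. IX §3.1 (9.19)] [cite: GriffithsHarrisPrinciples1978, Ch. 0 §2] -/
theorem fsPotDiffW_eq_of_mem_source {p : Ball} {y : orbitRel.Quotient Δ Ball} (hy : y ∈ (chart Δ p).source) :
    fsPotDiffW Δ k k' G G' y =
      (k' : ℝ) • (fsPotentialMForm (W := EuclideanSpace ℂ (Fin (N + 1)))).pullback 𝓘(ℝ, Fin 2 → ℂ)
          (G ∘ chart Δ p) y -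
        (k : ℝ) • (fsPotentialMForm (W := EuclideanSpace ℂ (Fin (N' + 1)))).pullback 𝓘(ℝ, Fin 2 → ℂ)
          (G' ∘ chart Δ p) y := by
  have hq := mem_chart_out_source (Δ := Δ) y
  obtain ⟨δ, hδ⟩ := eventually_transAt_eq hy hq
  -- the common rescaling function `u = j(δ, s_p ·)⁻¹`
  set u : orbitRel.Quotient Δ Ball → ℂ := fun y' ↦ (canonicalFactor (δ : U21) (chart Δ p y'))⁻¹ with hu
  have hev : (G ∘ chart Δ (Quotient.out y)) =ᶠ[𝓝 y] fun y' ↦ u y' ^ k • (G ∘ chart Δ p) y' := by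
    filter_upwards [hδ] with y' hy'
    simp only [Function.comp_apply, hu]
    rw [hy'.2.2.2, inv_pow]
    exact apply_smul_of_mem hG δ _
  have hev' : (G' ∘ chart Δ (Quotient.out y)) =ᶠ[𝓝 y] fun y' ↦ u y' ^ k' • (G' ∘ chart Δ p) y' := by
    filter_upwards [hδ] with y' hy'
    simp only [Function.comp_apply, hu]
    rw [hy'.2.2.2, inv_pow]
    exact apply_smul_of_mem hG' δ _
  have hud : MDifferentiableAt 𝓘(ℝ, Fin 2 → ℂ) 𝓘(ℝ, ℂ) u y :=
    ((isHolCocycle_canonicalFactor.mdifferentiable_inv (δ : U21) _).comp _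
      (mdifferentiableAt_chart hy)).real_of_complex
  have hu0 : u y ≠ 0 := inv_ne_zero (canonicalFactor_ne_zero _ _)
  simp only [fsPotDiffW]
  rw [fsPotentialMForm_pullback_congr_of_eventuallyEq hev, fsPotentialMForm_pullback_congr_of_eventuallyEq hev']
  ext v
  simp only [ContinuousAlternatingMap.sub_apply, ContinuousAlternatingMap.smul_apply, smul_eq_mul]
  rw [fsPotentialMForm_pullback_pow_smul_apply (G := G ∘ chart Δ p) hud (mdifferentiableAt_real_comp_chart hGh hy)
      hu0 (h0 _) k v,
    fsPotentialMForm_pullback_pow_smul_apply (G := G' ∘ chart Δ p) hud (mdifferentiableAt_real_comp_chart hGh' hy)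
      hu0 (h0' _) k' v]
  ring

include hGh hG h0 hGh' hG' h0' in
/-- Near every point, `fsPotDiffW` IS the weighted difference of two pulled-back potentials through one fixed
section. [cite: GriffithsHarrisPrinciples1978, Ch. 0 §2] -/
theorem fsPotDiffW_eventuallyEq (p : Ball) {y : orbitRel.Quotient Δ Ball} (hy : y ∈ (chart Δ p).source) :
    ∀ᶠ y' in 𝓝 y, fsPotDiffW Δ k k' G G' y' =
      ((k' : ℝ) • (fsPotentialMForm (W := EuclideanSpace ℂ (Fin (N + 1)))).pullback 𝓘(ℝ, Fin 2 → ℂ)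
          (G ∘ chart Δ p) -
        (k : ℝ) • (fsPotentialMForm (W := EuclideanSpace ℂ (Fin (N' + 1)))).pullback 𝓘(ℝ, Fin 2 → ℂ)
          (G' ∘ chart Δ p)) y' := by
  filter_upwards [(chart Δ p).open_source.mem_nhds hy] with y' hy'
  exact fsPotDiffW_eq_of_mem_source hGh hG h0 hGh' hG' h0' hy'

include hGh hG h0 hGh' hG' h0' in
/-- `fsPotDiffW` is a smooth `1`-form. [cite: GriffithsHarrisPrinciples1978, Ch. 0 §2] -/
theorem isSmoothForm_fsPotDiffW : IsSmoothForm (fsPotDiffW Δ k k' G G') := by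
  intro y
  have hy := mem_chart_out_source (Δ := Δ) y
  exact (((smoothAt_pullback_potential hGh hy h0).smul (k' : ℝ)).sub
    ((smoothAt_pullback_potential hGh' hy h0').smul (k : ℝ))).congr_of_eventuallyEq
    ((fsPotDiffW_eventuallyEq hGh hG h0 hGh' hG' h0' _ hy).mono fun _ h ↦ h.symm)

include hGh hG h0 hGh' hG' h0' in
/-- **`k' · [G]^*ω_FS − k · [G']^*ω_FS = d(fsPotDiffW)`** for two projective systems of weights `k`, `k'`.
[cite: GriffithsHarrisPrinciples1978, Ch. 0 §2 and Ch. 1 §2] -/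
theorem weight_smul_fsForm_sub_eq_mextDeriv :
    (k' : ℝ) • fsForm G hG h0 - (k : ℝ) • fsForm G' hG' h0' = mextDeriv (fsPotDiffW Δ k k' G G') := by
  funext y
  have hy := mem_chart_out_source (Δ := Δ) y
  set p := Quotient.out y
  set pb := (fsPotentialMForm (W := EuclideanSpace ℂ (Fin (N + 1)))).pullback 𝓘(ℝ, Fin 2 → ℂ) (G ∘ chart Δ p)
    with hpb
  set pb' := (fsPotentialMForm (W := EuclideanSpace ℂ (Fin (N' + 1)))).pullback 𝓘(ℝ, Fin 2 → ℂ) (G' ∘ chart Δ p)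
    with hpb'
  have hs : pb.SmoothAt y := smoothAt_pullback_potential hGh hy h0
  have hs' : pb'.SmoothAt y := smoothAt_pullback_potential hGh' hy h0'
  have hsub : (k' : ℝ) • pb - (k : ℝ) • pb' = (k' : ℝ) • pb + (-(k : ℝ)) • pb' := by
    rw [sub_eq_add_neg, neg_smul]
  rw [mextDeriv_congr_of_eventuallyEq (fsPotDiffW_eventuallyEq hGh hG h0 hGh' hG' h0' p hy), hsub,
    mextDeriv_add_apply (hs.smul _) (hs'.smul _), mextDeriv_smul, mextDeriv_smul, Pi.smul_apply, Pi.smul_apply,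
    hpb, hpb', mextDeriv_pullback_potential hGh hy h0, mextDeriv_pullback_potential hGh' hy h0', Pi.sub_apply,
    Pi.smul_apply, Pi.smul_apply, fsForm_eq_fsPullback_chart hGh hG h0 hy, fsForm_eq_fsPullback_chart hGh' hG' h0' hy,
    neg_smul, sub_eq_add_neg]

include hGh hG h0 hGh' hG' h0' in
/-- **The weight law for two systems**: `k' · [[G]^*ω_FS] = k · [[G']^*ω_FS]` in `H²_dR(Δ\𝔹²; ℝ)` for projective
systems of weights `k`, `k'` (no positivity of the weights is needed). [cite: GriffithsHarrisPrinciples1978, Ch. 1 §2] -/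
theorem weight_smul_deRhamCohomology_mk_fsForm_eq :
    (k' : ℝ) • deRhamCohomology.mk ⟨fsForm G hG h0, fsForm_mem_closedSmoothForms hGh hG h0⟩ =
      (k : ℝ) • deRhamCohomology.mk ⟨fsForm G' hG' h0', fsForm_mem_closedSmoothForms hGh' hG' h0'⟩ := by
  rw [← map_smul, ← map_smul, deRhamCohomology.mk_eq_mk_iff]
  show (k' : ℝ) • fsForm G hG h0 - (k : ℝ) • fsForm G' hG' h0' ∈
    exactSmoothForms 𝓘(ℝ, Fin 2 → ℂ) (orbitRel.Quotient Δ Ball) ℝ (1 + 1)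
  rw [weight_smul_fsForm_sub_eq_mextDeriv hGh hG h0 hGh' hG' h0']
  exact Submodule.subset_span ⟨fsPotDiffW Δ k k' G G',
    (mem_smoothForms_iff _).2 (isSmoothForm_fsPotDiffW hGh hG h0 hGh' hG' h0'), rfl⟩

end TwoWeights

/-! ### Discharge of the named fact -/

/-- **The weight law of Fubini–Study classes on a free ball quotient HOLDS** (discharge of the named fact
`BallFS.fsFormClass_weight_comm`, row B3-25′ / `L_FS`): for projective systems `G`, `G'` of automorphic forms of
weights `k, k' > 0` for `Δ`, `k' · [[G]^*ω_FS] = k · [[G']^*ω_FS]` in `H²_dR(Δ\𝔹²; ℝ)` — by weighted potential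
descent (`weight_smul_deRhamCohomology_mk_fsForm_eq`; the positivity hypotheses of the fact are not used).
[cite: GriffithsHarrisPrinciples1978, Ch. 1 §2 and Ch. 0 §2] [cite: Shafarevich1994, Ch. IX §3.2] -/
theorem fsFormClass_weight_comm_holds : fsFormClass_weight_comm := by
  intro Δ _ _ N N' k k' G G' hGh hG h0 hGh' hG' h0' _ _
  exact weight_smul_deRhamCohomology_mk_fsForm_eq hGh hG h0 hGh' hG' h0'

end BallFS

end Literature.AlgebraicGeometry.ShimuraVarieties

end
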